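import Summits.MatrixMultiplication.MatrixMultiplication.Theses.IrreducibleSublevelSets
import Literature.Computability.AlgebraicComplexity.CwEasyOmegaBound

/-!
# Crux `ManyAsymptoticRanks` (stmt-MatrixMultiplication-19018) — `Lines/birth.lean`, the BC3 birth skeleton

Route `IrreducibleSublevelSets` (route-MatrixMultiplication-IrreducibleSublevelSets; deciding theorem
`closes : SublevelIrreducible → IrreducibleFewBridge → ManyAsymptoticRanks → MatrixMultiplication`,
proved in the route file).  The crux (rank 3, the route's NEW link):

  `ManyAsymptoticRanks : 2 < ω(ℂ) → ∃ N, N·N·N + 1 < #{R~(T) : T ∈ ℂ^{N×N×N}}`  (as an `ℕ∞`-valued `encard`).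

## The line: exact values of padded cube sums + four ℚ-independent powers + a lattice count

The route header's TWO-LAYER PLAN for this crux, kernel-checked: if `2 < ω := ω(ℂ)` (and `ω < 2.41`,
tree `BCS1997_cor1543`), then

* `stub_spanFour` — **SpanFour** (number theory; transcendence / radicals): for every real `s` with
  `2 < s < 2.41` there are `n₁, n₂, n₃ ≥ 1` such that `1, n₁^s, n₂^s, n₃^s` admit NO non-trivial
  integer relation (equivalently: are ℚ-linearly independent).  Why true: `s` irrational ⇒ by the six
  exponentials theorem (tree: `Literature.NumberTheory.Transcendental.six_exponentials_holds`, with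
  `x = (1, s)`, `y = (log 2, log 3, log 5)`) some `θ = p^s`, `p ∈ {2, 3, 5}`, is transcendental, and
  `n = (p, p², p³)` gives `1, θ, θ², θ³`; `s = a/b` rational in lowest terms forces `b ≥ 3`
  (`2 < s < 2.41`), and `n = (2, 4, 8)` (`b ≥ 4`: `X^b - 2` irreducible, exponents `a, 2a, 3a`
  distinct and non-zero mod `b`) or `n = (2, 4, 3)` (`b = 3`, `s = 7/3`: `1, 2^{1/3}, 2^{2/3}, 3^{1/3}`
  independent since `3^{1/3} ∉ ℚ(2^{1/3})`) work.  Size L.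
* `stub_cubeSumValues` — **CubeSumValues** (tensors; the asymptotic sum inequality is EXACT on sums
  of cubes): for `n_j ≥ 1`, `c : Fin 3 → ℕ`, `m`, and `Σ_j c_j n_j² + m ≤ N` there is a tensor `T` in
  format `N × N × N` with `R~(T) = m + Σ_j c_j n_j^ω` — namely the zero-padded block-diagonal direct
  sum `⊕_j c_j·⟨n_j,n_j,n_j⟩ ⊕ m·⟨1,1,1⟩`.  Why true: `≥` is Schönhage's asymptotic sum inequality for
  `R~` (tree: `sum_rpow_omega_le_asymptoticRank`), `≤` is sub-additivity over cube blocks (tree: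
  `Theorems…asymptoticRank_matMulDirectSum_le`; refuter evidence `Value.lean` already has
  `R~(matMulDirectSum ℂ d d d) = Σ d_i^ω` sorry-free), and zero-padding into `Fin N` is a
  restriction both ways (`Theorems…asymptoticRank_eq_of_restrictsTo`).  Size M.
* `stub_latticeCount` — **LatticeCount** (elementary counting): for every `n : Fin 3 → ℕ` some `N`
  admits a finite set of more than `N³ + 1` pairs `(c, m) ∈ ℕ³ × ℕ` with `Σ_j c_j n_j² + m ≤ N`
  (the simplex count is `Θ(N⁴)`, e.g. `≥ N⁴ / (256 n₁² n₂² n₃²)`).  Size S–M.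
* `ManyAsymptoticRanks_of_stubs : <stub₁-sig> → <stub₂-sig> → <stub₃-sig> → <the crux statement verbatim>`
  — the composition as an explicit implication, a REAL proof (sorry-free, axioms `propext`,
  `Classical.choice`, `Quot.sound`): the value map `(c, m) ↦ m + Σ c_j n_j^ω` is INJECTIVE on `ℕ³ × ℕ`
  by `stub_spanFour` at `s = ω` (the difference of two representations is an integer relation), its
  image of the `stub_latticeCount` set lies in the value set of `R~` on format `N` by
  `stub_cubeSumValues`, and `encard` is monotone — so the value set has more than `N³ + 1` elements.
* `ManyAsymptoticRanks_of : ManyAsymptoticRanks` — THE REGISTERED SKELETON THEOREM (A12 shape of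
  `#h21_check_skeleton`: concludes the route decl
  `Summit.MatrixMultiplication.MatrixMultiplication.Theses.IrreducibleSublevelSets.ManyAsymptoticRanks`
  BY NAME, takes NO hypotheses, and its only `sorry`s are inside the three declared stubs it feeds to
  `ManyAsymptoticRanks_of_stubs`; closing the three stubs closes the crux).  It is the only theorem of
  the file whose conclusion is the crux constant, so the skeleton audit is unambiguous.

Honest status.  No stub is the crux or the summit in disguise: stub 1 is pure number theory (no
tensors), stub 3 pure combinatorics, stub 2 produces tensors with prescribed asymptotic ranks but says
nothing about how MANY distinct values arise (that needs the independence); BC3 probes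
`stub → ManyAsymptoticRanks` and `stub → MatrixMultiplication` by
`first | exact? | simpa [X] | (unfold X; simpa) | aesop` (and the short form `first | exact? | simpa | aesop`)
all FAIL — verdicts quoted in `Lines/birth.md`.  All three stubs are believed TRUE unconditionally
(the crux's only open input is its own hypothesis `2 < ω(ℂ)`, i.e. `¬ summit`; refuter note
rattack-19018: `S → C` trivially, so the crux is irrefutable short of disproving the summit).
Disproof used: none exists (`ledger crux ls stmt-MatrixMultiplication-19018`: no workfiles before this
one, no `Disproof.lean`, no `Negative/` lemma; `ledger negatives --problem MatrixMultiplication` = 11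
entries (2026-08-17), all TPP/STPP design statements — none about asymptotic-rank value sets,
transcendence or lattice counts), so no `_false_without_` obligation applies.
-/

-- `Summit.<Summit>.<Problem>`: for the single-conjunct summit the duplicate component is mandated.
set_option linter.dupNamespace false

noncomputable section

namespace Summit.MatrixMultiplication.MatrixMultiplication.Cruxes.ManyAsymptoticRanks.Birth

open scoped BigOperators
open Literature.Computability.AlgebraicComplexity

/-! ## The three registered stubs -/

/-- **Stub 1 — SpanFour** (four ℚ-independent `s`-th powers for a non-integer exponent
`2 < s < 2.41`): there are positive integers `n₁, n₂, n₃` such that `1, n₁^s, n₂^s, n₃^s` satisfy no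
non-trivial integer (equivalently rational) linear relation.  Irrational `s`: six exponentials theorem
(`Literature.NumberTheory.Transcendental.six_exponentials_holds`) with `x = (1, s)`,
`y = (log 2, log 3, log 5)` makes some `p^s` (`p ∈ {2,3,5}`) transcendental; take `n = (p, p², p³)`.
Rational `s = a/b`, `b ≥ 3`: radicals (`n = (2,4,8)` for `b ≥ 4`, `n = (2,4,3)` for `s = 7/3`).
Size L.  Sources: Lang1966 (Ch. II §1, Thm. 1), Waldschmidt2000 (§1.4),
lean:Literature.NumberTheory.Transcendental.six_exponentials_holds,
lean:Literature.Barriers.Schanuel.roy1992_strongSixExponentials_holds. -/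
theorem stub_spanFour :
    ∀ s : ℝ, 2 < s → s < 2.41 →
      ∃ n : Fin 3 → ℕ, (∀ j, 1 ≤ n j) ∧
        ∀ (b : ℤ) (a : Fin 3 → ℤ),
          (b : ℝ) + (∑ j, (a j : ℝ) * (n j : ℝ) ^ s) = 0 → b = 0 ∧ a = 0 := by
  sorry

/-- **Stub 2 — CubeSumValues** (exact asymptotic ranks of zero-padded cube sums): for block sizes
`n_j ≥ 1`, multiplicities `c_j`, `m` unit blocks and any `N ≥ Σ_j c_j n_j² + m`, some tensor of
format `N × N × N` over `ℂ` has asymptotic rank exactly `m + Σ_j c_j n_j^{ω(ℂ)}` — the block-diagonal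
`⊕_j c_j·⟨n_j,n_j,n_j⟩ ⊕ m·⟨1,1,1⟩` padded with zeros (`≥`: asymptotic sum inequality
`sum_rpow_omega_le_asymptoticRank`; `≤`: `asymptoticRank_matMulDirectSum_le` /
`asymptoticRank_directSumTensor_le_add` + `asymptoticRank_matMulTensor`; padding:
`asymptoticRank_eq_of_restrictsTo`).  Size M.  Sources: Schonhage1981, Strassen1988,
AlmanDuanVassilevskaWilliamsXuXuZhou2025 (Thm. 3.1),
lean:Literature.Computability.AlgebraicComplexity.sum_rpow_omega_le_asymptoticRank. -/
theorem stub_cubeSumValues :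
    ∀ n : Fin 3 → ℕ, (∀ j, 1 ≤ n j) → ∀ (c : Fin 3 → ℕ) (m N : ℕ),
      (∑ j, c j * n j ^ 2) + m ≤ N →
        ∃ T : Fin N → Fin N → Fin N → ℂ,
          Literature.Computability.AlgebraicComplexity.asymptoticRank T =
            (m : ℝ) + (∑ j, (c j : ℝ) * (n j : ℝ) ^ Literature.Computability.AlgebraicComplexity.omega ℂ) := by
  sorry

/-- **Stub 3 — LatticeCount** (the simplex `Σ_j c_j n_j² + m ≤ N` in `ℕ³ × ℕ` has more than `N³ + 1`
lattice points for some, indeed every large, `N`: the count is `Θ(N⁴)`).  Size S–M.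
Sources: folklore (lattice points in a dilated simplex); route header NUMBERS
(`≥ N⁴/(256 n₁² n₂² n₃²) > N³ + 1` once `N > 256 n₁² n₂² n₃² + 1`). -/
theorem stub_latticeCount :
    ∀ n : Fin 3 → ℕ, ∃ N : ℕ, ∃ S : Finset ((Fin 3 → ℕ) × ℕ),
      N * N * N + 1 < S.card ∧ ∀ cm ∈ S, (∑ j, cm.1 j * n j ^ 2) + cm.2 ≤ N := by
  sorry

/-! ## The composition: the three stub statements prove the crux BY NAME -/

/-- **The composition as an explicit implication.** The statement of the crux
`Summit.MatrixMultiplication.MatrixMultiplication.Theses.IrreducibleSublevelSets.ManyAsymptoticRanks`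
(stmt-MatrixMultiplication-19018), VERBATIM, from the three stub STATEMENTS as hypotheses: with
`2 < ω(ℂ) < 2.41` (`BCS1997_cor1543`) pick `n` by SpanFour at `s = ω(ℂ)`; the value map
`(c, m) ↦ m + Σ_j c_j n_j^ω` is injective on `ℕ³ × ℕ` (two representations differ by an integer
relation), maps the LatticeCount set into the set of asymptotic ranks of format `N × N × N`
(CubeSumValues), and `encard` is monotone.  Sorry-free; axioms `propext, Classical.choice, Quot.sound`.
(The conclusion is spelled out rather than named so that `ManyAsymptoticRanks_of` below is the
unique declaration concluding the crux constant — the shape `#h21_check_skeleton` registers.)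
[folklore] -/
theorem ManyAsymptoticRanks_of_stubs :
    (∀ s : ℝ, 2 < s → s < 2.41 →
      ∃ n : Fin 3 → ℕ, (∀ j, 1 ≤ n j) ∧
        ∀ (b : ℤ) (a : Fin 3 → ℤ),
          (b : ℝ) + (∑ j, (a j : ℝ) * (n j : ℝ) ^ s) = 0 → b = 0 ∧ a = 0) →
    (∀ n : Fin 3 → ℕ, (∀ j, 1 ≤ n j) → ∀ (c : Fin 3 → ℕ) (m N : ℕ),
      (∑ j, c j * n j ^ 2) + m ≤ N →
        ∃ T : Fin N → Fin N → Fin N → ℂ,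
          Literature.Computability.AlgebraicComplexity.asymptoticRank T =
            (m : ℝ) + (∑ j, (c j : ℝ) * (n j : ℝ) ^ Literature.Computability.AlgebraicComplexity.omega ℂ)) →
    (∀ n : Fin 3 → ℕ, ∃ N : ℕ, ∃ S : Finset ((Fin 3 → ℕ) × ℕ),
      N * N * N + 1 < S.card ∧ ∀ cm ∈ S, (∑ j, cm.1 j * n j ^ 2) + cm.2 ≤ N) →
    (2 < Literature.Computability.AlgebraicComplexity.omega ℂ →
      ∃ N : ℕ, ((N * N * N + 1 : ℕ) : ℕ∞) <
        (Set.range fun T : Fin N → Fin N → Fin N → ℂ =>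
          Literature.Computability.AlgebraicComplexity.asymptoticRank T).encard) := by
  intro h1 h2 h3 hω
  have hω' : omega ℂ < 2.41 := BCS1997_cor1543
  obtain ⟨n, hn1, hind⟩ := h1 (omega ℂ) hω hω'
  obtain ⟨N, S, hcard, hadm⟩ := h3 n
  refine ⟨N, ?_⟩
  -- the value map `(c, m) ↦ m + Σ c_j n_j^ω`
  set val : (Fin 3 → ℕ) × ℕ → ℝ :=
    fun cm => (cm.2 : ℝ) + (∑ j, (cm.1 j : ℝ) * (n j : ℝ) ^ omega ℂ) with hval
  -- injectivity from the absence of integer relations among `1, n_j^ω`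
  have hinj : Function.Injective val := by
    intro cm cm' h
    simp only [hval] at h
    have h0 : (((cm.2 : ℤ) - (cm'.2 : ℤ) : ℤ) : ℝ) +
        (∑ j, (((cm.1 j : ℤ) - (cm'.1 j : ℤ) : ℤ) : ℝ) * (n j : ℝ) ^ omega ℂ) = 0 := by
      push_cast
      simp only [sub_mul, Finset.sum_sub_distrib]
      linarith
    obtain ⟨hb, ha⟩ := hind _ _ h0
    refine Prod.ext ?_ ?_
    · funext j
      have hj := congr_fun ha j
      simp only [Pi.zero_apply, sub_eq_zero, Nat.cast_inj] at hj
      exact hj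
    · have hm : (cm.2 : ℤ) = cm'.2 := sub_eq_zero.mp hb
      exact_mod_cast hm
  -- every value of an admissible lattice point is an asymptotic rank in format `N × N × N`
  have hsub : val '' (S : Set ((Fin 3 → ℕ) × ℕ)) ⊆
      Set.range (fun T : Fin N → Fin N → Fin N → ℂ => asymptoticRank T) := by
    rintro _ ⟨cm, hcm, rfl⟩
    obtain ⟨T, hT⟩ := h2 n hn1 cm.1 cm.2 N (hadm cm (Finset.mem_coe.mp hcm))
    exact ⟨T, hT⟩
  calc ((N * N * N + 1 : ℕ) : ℕ∞) < ((S.card : ℕ) : ℕ∞) := by exact_mod_cast hcard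
    _ = (S : Set ((Fin 3 → ℕ) × ℕ)).encard := (Set.encard_coe_eq_coe_finsetCard S).symm
    _ = (val '' (S : Set ((Fin 3 → ℕ) × ℕ))).encard := (hinj.encard_image _).symm
    _ ≤ (Set.range (fun T : Fin N → Fin N → Fin N → ℂ => asymptoticRank T)).encard :=
        Set.encard_le_encard hsub

/-- **THE REGISTERED SKELETON THEOREM: `ManyAsymptoticRanks` from the three declared stubs.**
Concludes the route crux
`Summit.MatrixMultiplication.MatrixMultiplication.Theses.IrreducibleSublevelSets.ManyAsymptoticRanks`
BY NAME with no hypotheses (the route decl unfolds definitionally to the conclusion of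
`ManyAsymptoticRanks_of_stubs`); its only `sorry`s are inside `stub_spanFour`, `stub_cubeSumValues`,
`stub_latticeCount` — closing the three stubs closes the crux. [folklore] -/
theorem ManyAsymptoticRanks_of :
    Summit.MatrixMultiplication.MatrixMultiplication.Theses.IrreducibleSublevelSets.ManyAsymptoticRanks :=
  ManyAsymptoticRanks_of_stubs stub_spanFour stub_cubeSumValues stub_latticeCount

end Summit.MatrixMultiplication.MatrixMultiplication.Cruxes.ManyAsymptoticRanks.Birth

end
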